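import Literature.Probability.Percolation.NearCriticalCorrelationLength
import Literature.Probability.Percolation.KestenTheorem
import Literature.Probability.Percolation.TriRSWTwoScale
import Literature.Probability.Percolation.TriShiftedCrossings
import HarnessLib

/-!
# The near-critical correlation length of site percolation on `𝕋`: the lower bound `ξ ≳ L_ε`

Family: crit-perc (trunk StatMech). Continuation of `NearCriticalCorrelationLength.lean`, which
proved `ξ_rad(p) ≤ (2/c) L_ε(p)` from the radius decay beyond `L_ε` (Nolin 2008, §7.5) and
obtained the lower bound from Smirnov–Werner's power law for `ξ*`. Here the lower bound
`ξ_rad(p) ≥ L_ε(p) / C` is PROVED from the Russo–Seymour–Welsh theorem at general `p`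
(Nolin 2008, §3.1, Theorem "Russo–Seymour–Welsh" [arXiv: Thm. 2], vendored as the named fact `Nolin2008_RSW`) by the textbook construction
(Nolin 2008, §7.4, display before Cor. 42, "performing a RSW-type construction … yields
`P_p(𝒞_H([0, k L(p)] × [0, L(p)])) ≥ δ₂^{k-1} δ₁^{k-2} = C₁ e^{-C₂ k}`, so that `L(p)` is the
exact speed of decaying"; Kesten 1987; Chayes–Chayes–Fisher–Spencer): below the scale
`L_ε(p)` the sub-critical colour still crosses rhombi with probability `> ε` (definition of
`L_ε`), hence `2h × h` parallelograms with probability `≥ δ(ε)` (RSW), hence — chaining with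
Harris–FKG (`TriRSWChaining.lean`) — parallelograms of length `n` and height `h = L_ε - 1` with
probability `≥ e^{-C n / L_ε}`, for BOTH colours (the super-critical colour crosses even more
easily, by monotonicity in `p`). An open such crossing attached to an open column through the
origin gives `0 ↔ ∂Λ_n`; a closed frame in a square annulus beyond `Λ_n` (four closed long
crossings, independent of the former) makes the cluster of the origin finite
(`siteCluster_subset_box_of_mem_triClosedFrame`). Hence
`P_p(0 ↔ ∂Λ_n, |C(0)| < ∞) ≥ c₁(p) e^{-C₂ n / L_ε(p)}` (`exp_le_real_triOneArm_finite`), so the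
radius rate is `≤ C₂ / L_ε(p)` and `ξ_rad(p) ≥ L_ε(p) / C₂`, with `C₂ = C₂(ε)` uniform in `p`.

Together with the upper bound this gives `ξ_rad ≍ L_ε` near `p = 1/2` (Nolin 2008, §7.2, Theorem "Critical exponents" [arXiv: Thm. 31],
`ξ ≍ L`, and Cor. 42, `ξ̃ ≍ L_ε`, for the radius version of the correlation length), and the
exponent `ν = 4/3` of `triCorrLength` follows from that of `L_ε` (`KestenScaling.lean`:
`fourArm_exponent` and Kesten's relation `Nolin2008_prop34`) WITHOUT Smirnov–Werner's
Thm. 1 (iv) as an input: `triCorrLength_exponent_of_RSW : fourArm_exponent → Nolin2008_prop34 →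
Nolin2008_RSW → Nolin2008_radius_decay → triCorrLength_exponent`, and
`triCorrLength_exponent_of_RSW_lemma39_at` with the radius decay split into Nolin's Lemma 39 at
one `ε` and the supercritical white-circuit bound at that `ε`.

**Unconditional versions (2026-08).** The only use of `Nolin2008_RSW` in this chain is the chained
lower bound `exists_pow_le_triLRCrossingProb`; its conclusion is now also proved WITHOUT that fact
(`exists_pow_le_triLRCrossingProb_holds`) from the two-scale Russo–Seymour–Welsh theorem
`TriHexagon.triLRCrossingProb_two_scale` (`TriRSWTwoScale.lean`: Bollobás–Riordan's Lemma 4 and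
Cor. 5 run in lattice hexagons, at every density) — both scales used there lie below `L_ε(p)` —
and crude bounds at heights `≤ 5` (`triLRCrossingProb_le_mul`, `pow_succ_le_triLRCrossingProb`).
Accordingly every theorem below that took `(hRSW : Nolin2008_RSW)` has a version `…_of_chain`
taking the chained bound as a hypothesis (the original is its one-line corollary) and an
unconditional version (`exp_le_real_triOneArm_finite_holds`, `charLength_div_le_triCorrLength_le_holds`,
`triCorrLength_exponent_of_charLength_decay`, `triCorrLength_exponent_of_charLength_at`,
`triCorrLength_exponent_of_lemma39_at`): `fourArm_exponent → Nolin2008_prop34 →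
Nolin2008_radius_decay_at ε → triCorrLength_exponent` with no RSW hypothesis.

Contents: the named facts `Nolin2008_RSW_thm` (Nolin's RSW theorem of §3.1 [arXiv: Thm. 2] = RSW at general `p`, as printed, with
the functions `f_k`) and its two `∀∃` consequences `Nolin2008_RSW` (positivity part, `k = 2`, used
here) and `Nolin2008_RSW_one` (the "moreover" part `f_k(δ) → 1`, the input of Nolin's proof of
Lemma 39, consumed by the forthcoming proof of `Nolin2008_lemma39_at` by Nolin's block argument),
both DERIVED from `Nolin2008_RSW_thm`
(`Nolin2008_RSW_of_RSW_thm`, `Nolin2008_RSW_one_of_RSW_thm`); proved: the open column path on the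
left side `leftSide n h` of the parallelogram (`pathIn_leftSide`, `leftSide_open_event`; its
cardinality bound is the tree's `card_leftSide_le`, `KestenTheorem.lean`),
the chained lower bound below `L_ε`
(`exists_pow_le_triLRCrossingProb`), the lower bound
`exp_le_real_triOneArm_finite`, the rate bound `limsup_rateSeq_le_of_exp_le`, the two-sided comparison
`charLength_div_le_triCorrLength_le` and the assemblies.

Mathlib: real analysis only (`Real.log`, `Real.exp`, `Filter.limsup`). Tree: `charLength`,
`lt_triLRCrossingProb_of_lt_charLength`, `hasRightPowerLaw_charLength`,
`hasLeftPowerLaw_charLength` (`KestenScaling.lean`); `triLRCrossingProb_mono`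
(`TriHexExclusive.lean`); `annulus` (`ThermodynamicLimit.lean`); `triClosedFrame`,
`determinedBy_triClosedFrame_annulus`,
`pow_four_le_real_triClosedFrame`, `pow_mul_pow_le_triLRCrossingProb_of_le`, `triHCross`
(`TriRSWChaining.lean`); `div_le_limsup_rateSeq_of_radius_decay`, `tendsto_log_div_of_sandwich`,
`Nolin2008_radius_decay` (`NearCriticalCorrelationLength.lean`).
-/

noncomputable section

open Filter Topology MeasureTheory Finset
open scoped unitInterval

namespace Literature.Probability.Percolation

open LatticeModels

/-! ### The Russo–Seymour–Welsh theorem at general `p` (named facts) -/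

/-- **Nolin 2008, §3.1, Theorem "Russo–Seymour–Welsh" [arXiv 0711.4948: Thm. 2], aspect ratio `2`.** Printed: "There exist
universal non-decreasing functions `f_k` (`k ≥ 2`), that stay positive on `(0, 1)` and verify:
if for some parameter `p` the probability of crossing a `n × n` box is at least `δ₁`, then the
probability of crossing a `kn × n` parallelogram is at least `f_k(δ₁)`" (site percolation on the
triangular lattice, any `p ∈ [0, 1]`; Grimmett 1999, §11.7, Kesten 1982, Thm. 6.1 for the
method). Recorded for `k = 2` in `∀∃` form (`δ' = f₂(δ)`, using that `f₂` is non-decreasing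
and positive on `(0, 1)`), for the tree's crossing events `triLRCrossing n n`,
`triLRCrossing (2n) n` of the closed parallelograms `[0, n]²`, `[0, 2n] × [0, n]` (Nolin's
`𝒞_H` uses interior sites; the RSW theorem is insensitive to this convention) and `n ≥ 1`. [cite: Nolin2008, §3.1 Thm. "Russo–Seymour–Welsh" (arXiv: Thm. 2)] -/
def Nolin2008_RSW : Prop :=
  ∀ δ : ℝ, 0 < δ → δ < 1 → ∃ δ' : ℝ, 0 < δ' ∧
    ∀ (p : unitInterval) (n : ℕ), 1 ≤ n →
      δ ≤ triLRCrossingProb p n n → δ' ≤ triLRCrossingProb p (2 * n) n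

/-- **Nolin 2008, §3.1, Theorem "Russo–Seymour–Welsh" [arXiv 0711.4948: Thm. 2], the "moreover" part.** Printed: "Moreover, these
functions can be chosen satisfying the additional property: `f_k(δ) → 1` as `δ → 1`" (for every
`k ≥ 2`; `f_k` as in `Nolin2008_RSW`: if the `n × n` box is crossed with probability `≥ δ₁` under
`P_p`, the `kn × n` parallelogram is crossed the long way with probability `≥ f_k(δ₁)`). Recorded
in `∀∃` form: for every `k ≥ 2` and `η > 0` there is `δ₀ ∈ (0, 1)` such that, for every `p` and
`n ≥ 1`, `P_p(LR_𝕋(n, n)) ≥ δ₀` implies `P_p(LR_𝕋(kn, n)) ≥ 1 - η` (tree events `triLRCrossing`, as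
for `Nolin2008_RSW`). This is the input of Nolin's proof of Lemma 39 ("The RSW theory thus
entails that for all fixed `ε₁ > 0`, we can take `ε₀` sufficiently small to get automatically (and
independently of `p`) that `P_p(C_H([0, L(p)] × [0, 2L(p)])) ≤ ε₁`"). [cite: Nolin2008, §3.1 Thm. "Russo–Seymour–Welsh" (arXiv: Thm. 2), "Moreover"] -/
def Nolin2008_RSW_one : Prop :=
  ∀ k : ℕ, 2 ≤ k → ∀ η : ℝ, 0 < η → ∃ δ₀ : ℝ, 0 < δ₀ ∧ δ₀ < 1 ∧
    ∀ (p : unitInterval) (n : ℕ), 1 ≤ n →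
      δ₀ ≤ triLRCrossingProb p n n → 1 - η ≤ triLRCrossingProb p (k * n) n

/-- **Nolin 2008, §3.1, Theorem "Russo–Seymour–Welsh" [arXiv 0711.4948: Thm. 2], as printed.** "There exist universal
non-decreasing functions `f_k(.)` (`k ≥ 2`), that stay positive on `(0, 1)` and verify: if for
some parameter `p` the probability of crossing a `n × n` box is at least `δ₁`, then the probability
of crossing a `k n × n` parallelogram is at least `f_k(δ₁)`. Moreover, these functions can be
chosen satisfying the additional property: `f_k(δ) → 1` as `δ → 1`" (the printed rate
`f_k(1 - ε) = 1 - C_k ε^{α_k} + o(ε^{α_k})` is not recorded). Site percolation on `𝕋`, any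
`p ∈ [0, 1]`; tree events `triLRCrossing n n`, `triLRCrossing (k n) n` (closed parallelograms
`[0, n]²`, `[0, k n] × [0, n]`; Nolin's `𝒞_H` uses interior sites, a convention to which the RSW
theorem is insensitive) and `n ≥ 1`. The two `∀∃` consequences actually consumed downstream are
`Nolin2008_RSW` (positivity, `k = 2`) and `Nolin2008_RSW_one` (the limit `1`), derived below
(`Nolin2008_RSW_of_RSW_thm`, `Nolin2008_RSW_one_of_RSW_thm`). [cite: Nolin2008, §3.1 Thm. "Russo–Seymour–Welsh" (arXiv: Thm. 2)] -/
def Nolin2008_RSW_thm : Prop :=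
  ∃ f : ℕ → ℝ → ℝ,
    (∀ k : ℕ, 2 ≤ k → Monotone (f k)) ∧
    (∀ k : ℕ, 2 ≤ k → ∀ δ : ℝ, 0 < δ → δ < 1 → 0 < f k δ) ∧
    (∀ k : ℕ, 2 ≤ k → Tendsto (f k) (𝓝[<] 1) (𝓝 1)) ∧
    ∀ k : ℕ, 2 ≤ k → ∀ (p : unitInterval) (n : ℕ), 1 ≤ n → ∀ δ₁ : ℝ,
      δ₁ ≤ triLRCrossingProb p n n → f k δ₁ ≤ triLRCrossingProb p (k * n) n

/-- `Nolin2008_RSW_thm → Nolin2008_RSW` (take `δ' = f₂(δ)`). [cite: Nolin2008, §3.1 Thm. "Russo–Seymour–Welsh" (arXiv: Thm. 2)] -/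
theorem Nolin2008_RSW_of_RSW_thm (h : Nolin2008_RSW_thm) : Nolin2008_RSW := by
  obtain ⟨f, -, hpos, -, hf⟩ := h
  intro δ hδ hδ1
  refine ⟨f 2 δ, hpos 2 le_rfl δ hδ hδ1, fun p n hn hδP => ?_⟩
  exact hf 2 le_rfl p n hn δ hδP

/-- `Nolin2008_RSW_thm → Nolin2008_RSW_one` (`f_k(δ) → 1` as `δ ↑ 1`: choose `δ₀ < 1` with
`f_k > 1 - η` on `(δ₀', 1)` and `δ₀ = max (1/2) ((δ₀' + 1)/2)`). [cite: Nolin2008, §3.1 Thm. "Russo–Seymour–Welsh" (arXiv: Thm. 2), "Moreover"] -/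
theorem Nolin2008_RSW_one_of_RSW_thm (h : Nolin2008_RSW_thm) : Nolin2008_RSW_one := by
  obtain ⟨f, -, -, hlim, hf⟩ := h
  intro k hk η hη
  have hev : ∀ᶠ δ in 𝓝[<] (1 : ℝ), 1 - η < f k δ :=
    (hlim k hk).eventually (lt_mem_nhds (by linarith))
  obtain ⟨l, hl1, hl⟩ := mem_nhdsLT_iff_exists_Ioo_subset.1 hev
  have hl1' : l < 1 := hl1
  set δ₀ : ℝ := max (1 / 2) ((l + 1) / 2) with hδ₀
  have hδ₀1 : δ₀ < 1 := max_lt (by norm_num) (by linarith)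
  have hδ₀0 : 0 < δ₀ := lt_of_lt_of_le (by norm_num) (le_max_left _ _)
  have hlδ₀ : l < δ₀ := lt_of_lt_of_le (by linarith) (le_max_right _ _)
  refine ⟨δ₀, hδ₀0, hδ₀1, fun p n hn hP => ?_⟩
  have h1 : 1 - η < f k δ₀ := hl ⟨hlδ₀, hδ₀1⟩
  have h2 : f k δ₀ ≤ triLRCrossingProb p (k * n) n := hf k hk p n hn δ₀ hP
  linarith

/-! ### Monotonicity in `p` and the chained lower bound below `L_ε` -/

/-- The sub-critical parameter `min p (1 - p)` is below both `p` and `1 - p`. [folklore] -/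
theorem min_symm_le (p : unitInterval) : min p (σ p) ≤ p ∧ min p (σ p) ≤ σ p :=
  ⟨min_le_left _ _, min_le_right _ _⟩

/-- **Long crossings below the characteristic length cost `e^{-O(n/L)}`, for both colours**
(Nolin 2008, §7.4, display before Cor. 42: "a RSW-type construction yields
`P_p(𝒞_H([0, k L] × [0, L])) ≥ δ₂^{k-1} δ₁^{k-2} = C₁ e^{-C₂ k}`"; here at height
`h = L_ε(p) - 1`). If `Nolin2008_RSW` holds, then for every `ε ∈ (0, 1/2)` there is
`η ∈ (0, 1]` such that for all `p` with `L = L_ε(p) ≥ 2`, every parameter `q ≥ min(p, 1-p)`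
(in particular `q = p` and `q = 1 - p`), and all widths `w` and `j ≥ 1` with `w ≤ (j+1)(L-1)`:
`P_q(LR_𝕋(w, L - 1)) ≥ η^j`. Proof: `ε < P_{min(p,1-p)}(LR(L-1, L-1))` (definition of `L_ε`),
RSW, monotonicity in the parameter, chaining. [cite: Nolin2008, §7.4 (display before Cor. 42 (arXiv: Cor. 40))] -/
theorem exists_pow_le_triLRCrossingProb (hRSW : Nolin2008_RSW) {ε : ℝ} (hε : 0 < ε) (hε' : ε < 1 / 2) :
    ∃ η : ℝ, 0 < η ∧ η ≤ 1 ∧ ∀ (p q : unitInterval), min p (σ p) ≤ q → 2 ≤ charLength ε p →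
      ∀ (j w : ℕ), 1 ≤ j → w ≤ (j + 1) * (charLength ε p - 1) →
        η ^ j ≤ triLRCrossingProb q w (charLength ε p - 1) := by
  obtain ⟨δ', hδ', hR⟩ := hRSW ε hε (by linarith)
  refine ⟨min δ' 1 * ε, by positivity, mul_le_one₀ (min_le_right _ _) hε.le (by linarith), ?_⟩
  intro p q hq hL j w hj hw
  set h := charLength ε p - 1 with hh
  have hh1 : 1 ≤ h := by omega
  have hlt : h < charLength ε p := by omega
  have hεP : ε < triLRCrossingProb (min p (σ p)) h h := lt_triLRCrossingProb_of_lt_charLength hlt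
  have h₂ : ε ≤ triLRCrossingProb q h h := hεP.le.trans (Literature.Probability.Percolation.TriHexExclusive.triLRCrossingProb_mono hq h h)
  have h₁ : min δ' 1 ≤ triLRCrossingProb q (2 * h) h :=
    (min_le_left _ _).trans ((hR (min p (σ p)) h hh1 hεP.le).trans
      (Literature.Probability.Percolation.TriHexExclusive.triLRCrossingProb_mono hq (2 * h) h))
  have hε1 : ε ≤ 1 := by linarith
  calc (min δ' 1 * ε) ^ j = (min δ' 1) ^ j * ε ^ j := mul_pow _ _ _
    _ ≤ (min δ' 1) ^ j * ε ^ (j - 1) :=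
        mul_le_mul_of_nonneg_left (pow_le_pow_of_le_one hε.le hε1 (Nat.sub_le j 1))
          (pow_nonneg (le_min hδ'.le zero_le_one) j)
    _ ≤ triLRCrossingProb q w h :=
        pow_mul_pow_le_triLRCrossingProb_of_le q h (le_min hδ'.le zero_le_one) hε.le h₁ h₂ hj hw

/-- The chained lower bound below `L_ε` as a hypothesis (the conclusion of
`exists_pow_le_triLRCrossingProb`), through which alone the RSW input enters this file. [cite: Nolin2008, §7.4 (display before Cor. 42 (arXiv: Cor. 40))] -/
def ChainBound (ε : ℝ) : Prop :=
  ∃ η : ℝ, 0 < η ∧ η ≤ 1 ∧ ∀ (p q : unitInterval), min p (σ p) ≤ q → 2 ≤ charLength ε p →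
    ∀ (j w : ℕ), 1 ≤ j → w ≤ (j + 1) * (charLength ε p - 1) →
      η ^ j ≤ triLRCrossingProb q w (charLength ε p - 1)

/-- `ChainBound ε` from `Nolin2008_RSW`. [cite: Nolin2008, §7.4 (display before Cor. 42 (arXiv: Cor. 40))] -/
theorem chainBound_of_RSW (hRSW : Nolin2008_RSW) {ε : ℝ} (hε : 0 < ε) (hε' : ε < 1 / 2) : ChainBound ε :=
  exists_pow_le_triLRCrossingProb hRSW hε hε'

/-! ### Crude crossing bounds at small heights -/

/-- `P_p(LR_𝕋(m, n)) ≤ (n + 1) p`: a left–right crossing starts at an open site of the left side.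
[folklore] -/
theorem triLRCrossingProb_le_mul (p : unitInterval) (m n : ℕ) :
    triLRCrossingProb p m n ≤ (n + 1) * p := by
  classical
  have hsub : triLRCrossing m n ⊆ ⋃ x ∈ leftSide m n, {ω : SiteConfig (Site 2) | x ∈ ω} := by
    rintro ω ⟨x, hx, y, -, hω⟩
    exact Set.mem_iUnion₂.2 ⟨x, hx, (PathIn.of_mem_siteConnIn hω).left_mem.2⟩
  calc triLRCrossingProb p m n ≤ (triSitePercolation p).real (⋃ x ∈ leftSide m n, {ω : SiteConfig (Site 2) | x ∈ ω}) :=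
        measureReal_mono hsub (measure_ne_top _ _)
    _ ≤ ∑ x ∈ leftSide m n, (triSitePercolation p).real {ω : SiteConfig (Site 2) | x ∈ ω} :=
        measureReal_biUnion_finset_le _ _
    _ = (leftSide m n).card * p := by
        unfold triSitePercolation
        simp only [sitePercolation_real_mem, Finset.sum_const, nsmul_eq_mul]
    _ ≤ (n + 1) * p := by
        have := card_leftSide_le m n
        exact mul_le_mul_of_nonneg_right (by exact_mod_cast this) p.2.1

/-- `|bottomSide m n| ≤ m + 1`. [folklore] -/
theorem card_bottomSide_le (m n : ℕ) : (bottomSide m n).card ≤ m + 1 := by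
  have hsub : bottomSide m n ⊆ (Finset.range (m + 1)).image fun t : ℕ => (![(t : ℤ), 0] : Site 2) := by
    intro x hx
    simp only [bottomSide, Finset.mem_filter, mem_rectangle_iff] at hx
    obtain ⟨⟨h0, h1, -, -⟩, hx1⟩ := hx
    refine Finset.mem_image.2 ⟨(x 0).toNat, Finset.mem_range.2 (by omega), ?_⟩
    ext i; fin_cases i
    · simp only [Fin.zero_eta, Matrix.cons_val_zero]; exact Int.toNat_of_nonneg h0
    · simp [hx1]
  exact (Finset.card_le_card hsub).trans (Finset.card_image_le.trans (Finset.card_range _).le)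

/-- `P_p(LR_𝕋(m, n)) ≥ p^{m+1}`: if the bottom row is open it is a left–right crossing. [folklore] -/
theorem pow_succ_le_triLRCrossingProb (p : unitInterval) (m n : ℕ) :
    (p : ℝ) ^ (m + 1) ≤ triLRCrossingProb p m n := by
  have hsub : {ω : SiteConfig (Site 2) | (↑(bottomSide m n) : Set (Site 2)) ⊆ ω} ⊆ triLRCrossing m n := by
    intro ω hω
    have hmem : ∀ i : ℕ, i ≤ m → (0 : Site 2) + (i : ℤ) • triE0 ∈ (↑(rectangle m n) : Set (Site 2)) ∩ ω := by
      intro i hi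
      have hb : (0 : Site 2) + (i : ℤ) • triE0 ∈ bottomSide m n := by
        refine Finset.mem_filter.2 ⟨mem_rectangle_iff.2 ?_, by simp [triE0]⟩
        simp [triE0]; omega
      exact ⟨Finset.mem_coe.2 (Finset.mem_filter.1 hb).1, hω (Finset.mem_coe.2 hb)⟩
    have hpath : PathIn triGraph ((↑(rectangle m n) : Set (Site 2)) ∩ ω) 0 ((0 : Site 2) + (m : ℤ) • triE0) :=
      triPathIn_row_right m hmem
    refine ⟨0, ?_, (0 : Site 2) + (m : ℤ) • triE0, ?_, hpath.mem_siteConnIn⟩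
    · exact Finset.mem_filter.2 ⟨mem_rectangle_iff.2 (by simp), rfl⟩
    · exact Finset.mem_filter.2 ⟨mem_rectangle_iff.2 (by simp [triE0]), by simp [triE0]⟩
  calc (p : ℝ) ^ (m + 1) ≤ (p : ℝ) ^ (bottomSide m n).card := pow_le_pow_of_le_one p.2.1 p.2.2 (card_bottomSide_le m n)
    _ = (triSitePercolation p).real {ω : SiteConfig (Site 2) | (↑(bottomSide m n) : Set (Site 2)) ⊆ ω} := by
        unfold triSitePercolation; rw [sitePercolation_real_subset]
    _ ≤ triLRCrossingProb p m n := measureReal_mono hsub (measure_ne_top _ _)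

/-! ### Long crossings below `L_ε`, without the RSW fact -/

/-- **Long crossings below the characteristic length cost `e^{-O(n/L)}`, unconditionally.** The
conclusion of `exists_pow_le_triLRCrossingProb` without the hypothesis `Nolin2008_RSW`: for every
`ε ∈ (0, 1/2)` there is `η ∈ (0, 1]` such that for all `p` with `L = L_ε(p) ≥ 2`, every
`q ≥ min(p, 1-p)`, all `w` and `j ≥ 1` with `w ≤ (j+1)(L-1)`: `P_q(LR_𝕋(w, L-1)) ≥ η^j`. The
single-scale RSW input is replaced by the two-scale theorem `triLRCrossingProb_two_scale`
(Bollobás–Riordan's Lemma 4 / Cor. 5 in lattice hexagons, every density): both scales `2j₀` and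
`4j₀ + 2 ≤ L - 1` lie below `L_ε(p)`, where the rhombus crossing probability exceeds `ε`
(`lt_triLRCrossingProb_of_lt_charLength`); heights `L - 1 ≤ 5` are handled by the crude bounds
`triLRCrossingProb_le_mul`, `pow_succ_le_triLRCrossingProb`. [cite: Nolin2008, §7.4 (display before Cor. 42 (arXiv: Cor. 40))] [cite: BollobasRiordan2006, Ch. 3 Lemma 4, Cor. 5] -/
theorem exists_pow_le_triLRCrossingProb_holds {ε : ℝ} (hε : 0 < ε) (hε' : ε < 1 / 2) :
    ∃ η : ℝ, 0 < η ∧ η ≤ 1 ∧ ∀ (p q : unitInterval), min p (σ p) ≤ q → 2 ≤ charLength ε p →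
      ∀ (j w : ℕ), 1 ≤ j → w ≤ (j + 1) * (charLength ε p - 1) →
        η ^ j ≤ triLRCrossingProb q w (charLength ε p - 1) := by
  have hε1 : ε ≤ 1 := by linarith
  obtain ⟨δ₁, hδ₁⟩ : ∃ δ₁ : ℝ, δ₁ = (ε / 2) ^ 396 := ⟨_, rfl⟩
  have hδ₁0 : 0 < δ₁ := by rw [hδ₁]; positivity
  have hδ₁1 : δ₁ ≤ 1 := by rw [hδ₁]; exact pow_le_one₀ (by positivity) (by linarith)
  -- the two regimes give `η_big = δ₁³ ε²` and `η_small = (ε/6)^11`; take the minimum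
  set η : ℝ := min (δ₁ ^ 3 * ε ^ 2) ((ε / 6) ^ 11) with hη
  have hη0 : 0 < η := lt_min (by positivity) (by positivity)
  have hη1 : η ≤ 1 := (min_le_left _ _).trans (by
    calc δ₁ ^ 3 * ε ^ 2 ≤ 1 ^ 3 * 1 ^ 2 := by gcongr
      _ = 1 := by norm_num)
  refine ⟨η, hη0, hη1, ?_⟩
  intro p q hq hL j w hj hw
  set h := charLength ε p - 1 with hh
  have hh1 : 1 ≤ h := by omega
  -- crossing probabilities at all scales `< L` exceed `ε`, also at `q`
  have hscale : ∀ m : ℕ, m ≤ h → ε ≤ triLRCrossingProb q m m := fun m hm =>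
    (lt_triLRCrossingProb_of_lt_charLength (by omega : m < charLength ε p)).le.trans
      (TriHexExclusive.triLRCrossingProb_mono hq m m)
  by_cases hbig : 6 ≤ h
  · -- two-scale RSW at height `n = 4 j₀ + 2 ≤ h`, then chaining and monotonicity in the height
    set j₀ : ℕ := (h - 2) / 4 with hj₀
    have hj₀1 : 1 ≤ j₀ := by omega
    set n : ℕ := 4 * j₀ + 2 with hn
    have hnh : n ≤ h := by omega
    have hhn : h ≤ 2 * n := by omega
    have h2 : δ₁ ≤ triLRCrossingProb q (2 * n) n := by
      have := TriHexagon.triLRCrossingProb_two_scale q hj₀1 hε.le (hscale (2 * j₀) (by omega)) (hscale n hnh)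
      rw [hδ₁]; convert this using 2; omega
    have hchain := pow_mul_pow_le_triLRCrossingProb_of_le q n hδ₁0.le hε.le h2 (hscale n hnh)
      (j := 2 * j + 1) (by omega) (w := w) (by nlinarith)
    calc η ^ j ≤ (δ₁ ^ 3 * ε ^ 2) ^ j := pow_le_pow_left₀ hη0.le (min_le_left _ _) j
      _ = δ₁ ^ (3 * j) * ε ^ (2 * j) := by ring
      _ ≤ δ₁ ^ (2 * j + 1) * ε ^ (2 * j + 1 - 1) := by
          rw [show 2 * j + 1 - 1 = 2 * j from by omega]
          exact mul_le_mul_of_nonneg_right (pow_le_pow_of_le_one hδ₁0.le hδ₁1 (by omega)) (by positivity)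
      _ ≤ triLRCrossingProb q w n := hchain
      _ ≤ triLRCrossingProb q w h := triLRCrossingProb_mono_height q w hnh
  · -- small heights: `q > ε / 6` and the open bottom row
    have hh5 : h ≤ 5 := by omega
    have hqε : ε / 6 ≤ q := by
      have h1 : ε ≤ (h + 1) * (q : ℝ) := (hscale h le_rfl).trans (triLRCrossingProb_le_mul q h h)
      have h6 : ((h : ℝ) + 1) ≤ 6 := by exact_mod_cast (by omega : h + 1 ≤ 6)
      have hq0 : 0 ≤ (q : ℝ) := q.2.1
      nlinarith
    have hw' : w + 1 ≤ 11 * j := by nlinarith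
    calc η ^ j ≤ ((ε / 6) ^ 11) ^ j := pow_le_pow_left₀ hη0.le (min_le_right _ _) j
      _ = (ε / 6) ^ (11 * j) := by rw [← pow_mul]
      _ ≤ (ε / 6) ^ (w + 1) := pow_le_pow_of_le_one (by positivity) (by linarith) hw'
      _ ≤ (q : ℝ) ^ (w + 1) := pow_le_pow_left₀ (by positivity) hqε _
      _ ≤ triLRCrossingProb q w h := pow_succ_le_triLRCrossingProb q w h

/-- **`ChainBound ε` holds unconditionally** for `ε ∈ (0, 1/2)`. [cite: BollobasRiordan2006, Ch. 3 Lemma 4, Cor. 5] -/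
theorem chainBound_holds {ε : ℝ} (hε : 0 < ε) (hε' : ε < 1 / 2) : ChainBound ε :=
  exists_pow_le_triLRCrossingProb_holds hε hε'

/-! ### The open column through the origin: the left side of `[0, n] × [0, h]` -/

-- `(leftSide n h).card ≤ h + 1` is the tree's `card_leftSide_le` (`KestenTheorem.lean`).

/-- `(0, t) ∈ leftSide n h` for `t ≤ h`. [folklore] -/
theorem axis_mem_leftSide {n h t : ℕ} (ht : t ≤ h) : (![(0 : ℤ), (t : ℤ)] : Site 2) ∈ leftSide n h := by
  refine Finset.mem_filter.2 ⟨mem_rectangle_iff.2 ?_, rfl⟩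
  simp only [Matrix.cons_val_zero, Matrix.cons_val_one, Matrix.cons_val_fin_one]
  omega

/-- If the left side of `R(n, h)` is open, the origin is joined by open sites of it to each of its
sites. [folklore] -/
theorem pathIn_leftSide {ω : SiteConfig (Site 2)} {n h : ℕ} (hω : (↑(leftSide n h) : Set (Site 2)) ⊆ ω)
    (t : ℕ) (ht : t ≤ h) : PathIn triGraph ω 0 ![(0 : ℤ), (t : ℤ)] := by
  induction t with
  | zero =>
    have h0 : (![(0 : ℤ), ((0 : ℕ) : ℤ)] : Site 2) = 0 := by
      ext i; fin_cases i <;> rfl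
    rw [h0]
    refine PathIn.refl (hω ?_)
    rw [Finset.mem_coe, ← h0]
    exact axis_mem_leftSide (Nat.zero_le h)
  | succ t ih =>
    refine (ih (by omega)).tail ?_ (hω (Finset.mem_coe.2 (axis_mem_leftSide ht)))
    exact zdGraph_le_triGraph (zdGraph_two_adj_of_coord (Or.inr (Or.inr (Or.inl
      ⟨by simp, by simp⟩))))

/-- The event "the left side of `R(n, h)` is open" is determined by the sites of the
parallelogram `[0, n] × [0, h]` and increasing, of probability `≥ p^{h+1}`. [folklore] -/
theorem leftSide_open_event (p : unitInterval) (n h : ℕ) :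
    DeterminedBy {ω : SiteConfig (Site 2) | (↑(leftSide n h) : Set (Site 2)) ⊆ ω}
        ↑(triStripFinset 0 0 n h) ∧
      IsUpperSet {ω : SiteConfig (Site 2) | (↑(leftSide n h) : Set (Site 2)) ⊆ ω} ∧
      (p : ℝ) ^ (h + 1) ≤ (triSitePercolation p).real
        {ω : SiteConfig (Site 2) | (↑(leftSide n h) : Set (Site 2)) ⊆ ω} := by
  have hsub : (↑(leftSide n h) : Set (Site 2)) ⊆ ↑(triStripFinset 0 0 n h) := fun z hz => by
    have h1 := mem_rectangle_iff.1 (Finset.mem_filter.1 (Finset.mem_coe.1 hz)).1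
    rw [coe_triStripFinset, mem_triStrip]
    omega
  refine ⟨?_, fun ω ω' hle hω => Set.Subset.trans hω hle, ?_⟩
  · rw [determinedBy_iff]
    intro ω ω' hω
    simp only [Set.mem_setOf_eq]
    constructor
    · intro h1 v hv
      have : v ∈ ω ∩ ↑(triStripFinset 0 0 n h) := ⟨h1 hv, hsub hv⟩
      rw [hω] at this; exact this.1
    · intro h1 v hv
      have : v ∈ ω' ∩ ↑(triStripFinset 0 0 n h) := ⟨h1 hv, hsub hv⟩
      rw [← hω] at this; exact this.1
  · unfold triSitePercolation
    rw [sitePercolation_real_subset]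
    exact pow_le_pow_of_le_one p.2.1 p.2.2 (card_leftSide_le n h)

/-! ### The lower bound `P_p(0 ↔ ∂Λ_n, |C(0)| < ∞) ≥ c₁ e^{-C₂ n / L_ε(p)}` -/

/-- **The construction.** If the column `{0} × [0, h]` (the left side of `[0, n] × [0, h]`) is
open, `[0, n] × [0, h]` is crossed horizontally by open sites and the square annulus
`S_{2M} ∖ S_M°` (`M = n + h + 1`) carries a closed frame, then `0 ↔ ∂Λ_n` and `|C(0)| < ∞`
(`n ≥ 1`). [folklore] -/
theorem column_cross_frame_subset {n h : ℕ} (hn : 1 ≤ n) :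
    ({ω : SiteConfig (Site 2) | (↑(leftSide n h) : Set (Site 2)) ⊆ ω} ∩ triHCross 0 0 n h) ∩
        triClosedFrame (n + h + 1) ⊆
      triOneArm n ∩ (sitePercolatesAt triGraph 0)ᶜ := by
  rintro ω ⟨⟨hcol, hcross⟩, hframe⟩
  refine ⟨?_, triClosedFrame_subset_not_percolates (by omega) hframe⟩
  obtain ⟨x, y, hx0, hy0, hpath⟩ := hcross
  have hx := hpath.left_mem.1
  simp only [mem_triStrip] at hx
  -- `x = (0, t)` with `0 ≤ t ≤ h`
  obtain ⟨t, ht⟩ : ∃ t : ℕ, (t : ℤ) = x 1 := ⟨(x 1).toNat, Int.toNat_of_nonneg hx.2.2.1⟩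
  have hxe : x = ![(0 : ℤ), (t : ℤ)] := by
    rw [Site.eq_iff_two]; simp [hx0, ht]
  have hth : t ≤ h := by have := hx.2.2.2; omega
  have p1 : PathIn triGraph ω 0 x := by rw [hxe]; exact pathIn_leftSide hcol t hth
  have p2 : PathIn triGraph ω x y := hpath.mono Set.inter_subset_right
  refine mem_triOneArm_of_pathIn_of_le_triNorm (p1.trans p2) hn ?_
  calc (n : ℤ) = |y 0| := by rw [hy0]; simp
    _ ≤ triNorm y := le_max_left _ _

/-- The strip `[0, n] × [0, h]` is disjoint from the square annulus at scale `M = n + h + 1`. [folklore] -/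
theorem disjoint_strip_annulus (n h : ℕ) :
    Disjoint (triStripFinset 0 0 n h) (annulus 2 (n + h + 1 - 1) (2 * (n + h + 1))) := by
  rw [Finset.disjoint_left]
  intro z hz hz'
  rw [Nat.add_sub_cancel, mem_annulus, mem_box, mem_box, Fin.forall_fin_two, Fin.forall_fin_two] at hz'
  push_cast at hz'
  rw [← Finset.mem_coe, coe_triStripFinset, mem_triStrip] at hz
  omega

/-- **The lower bound.** Fix `ε ∈ (0, 1/2)` and assume the chained bound `ChainBound ε` with
`η = η(ε)` (e.g. from `exists_pow_le_triLRCrossingProb`). For every `p` with `L = L_ε(p) ≥ 2` and every `n ≥ 1`,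
`P_p(0 ↔ ∂Λ_n, |C(0)| < ∞) ≥ p^L · η^{37} · exp (-(34 |log η| / L) · n)`: the open column
(`p^L`), the open crossing of `[0, n] × [0, L-1]` (`η^{j₁}`, `j₁ = ⌊n/(L-1)⌋ + 1`), and the
closed frame at scale `M = n + L` (`(η^{j₂})⁴`, `j₂ = ⌊4M/(L-1)⌋ + 1 ≤ 8n/L + 9`), combined by Harris–FKG
and disjoint-support independence. (Nolin 2008, §7.4–7.5: the RSW-type construction; Kesten
1987.) [cite: Nolin2008, §7.4 (display before Cor. 42 (arXiv: Cor. 40))] -/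
theorem exp_le_real_triOneArm_finite_of_chain {ε : ℝ} (hchain0 : ChainBound ε) :
    ∃ η : ℝ, 0 < η ∧ η ≤ 1 ∧ ∀ p : unitInterval, 2 ≤ charLength ε p → ∀ n : ℕ, 1 ≤ n →
      (p : ℝ) ^ charLength ε p * η ^ 37 *
          Real.exp (-(34 * |Real.log η| / charLength ε p * n)) ≤
        (triSitePercolation p).real (triOneArm n ∩ (sitePercolatesAt triGraph 0)ᶜ) := by
  obtain ⟨η, hη, hη1, hchain⟩ := hchain0
  refine ⟨η, hη, hη1, fun p hL n hn => ?_⟩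
  set L := charLength ε p with hLdef
  set h := L - 1 with hh
  have hh1 : 1 ≤ h := by omega
  set M := n + h + 1 with hM
  -- the three events
  set Acol : Set (SiteConfig (Site 2)) := {ω | (↑(leftSide n h) : Set (Site 2)) ⊆ ω} with hAcol
  set Across : Set (SiteConfig (Site 2)) := triHCross 0 0 n h with hAcross
  set Aframe : Set (SiteConfig (Site 2)) := triClosedFrame M with hAframe
  obtain ⟨hcol_det, hcol_up, hcol_P⟩ := leftSide_open_event p n h
  -- probabilities of the pieces
  set j₁ := n / h + 1 with hj₁
  set j₂ := 4 * M / h + 1 with hj₂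
  have hj₁1 : 1 ≤ j₁ := Nat.le_add_left 1 _
  have hj₂1 : 1 ≤ j₂ := Nat.le_add_left 1 _
  have hw₁ : n ≤ (j₁ + 1) * (L - 1) := by
    rw [← hh, hj₁]
    have := Nat.div_add_mod n h
    have := Nat.mod_lt n (show 0 < h by omega)
    nlinarith
  have hw₂ : 4 * M ≤ (j₂ + 1) * (L - 1) := by
    rw [← hh, hj₂]
    have := Nat.div_add_mod (4 * M) h
    have := Nat.mod_lt (4 * M) (show 0 < h by omega)
    nlinarith
  have hcross_P : η ^ j₁ ≤ (triSitePercolation p).real Across := by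
    rw [hAcross, triSitePercolation_real_triHCross]
    exact hchain p p (min_symm_le p).1 hL j₁ n hj₁1 hw₁
  have hframe_P : (η ^ j₂) ^ 4 ≤ (triSitePercolation p).real Aframe := by
    refine le_trans ?_ (pow_four_le_real_triClosedFrame p M)
    have h0 : 0 ≤ η ^ j₂ := pow_nonneg hη.le _
    have h1 : η ^ j₂ ≤ triLRCrossingProb (σ p) (4 * M) M :=
      calc η ^ j₂ ≤ triLRCrossingProb (σ p) (4 * M) h :=
            hchain p (σ p) (min_symm_le p).2 hL j₂ (4 * M) hj₂1 hw₂
        _ ≤ triLRCrossingProb (σ p) (4 * M) M := triLRCrossingProb_mono_height _ _ (by omega)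
    exact pow_le_pow_left₀ h0 h1 4
  -- Harris for the two open events, independence from the closed frame
  have hcross_det : DeterminedBy Across ↑(triStripFinset 0 0 n h) := determinedBy_triHCross 0 0 n h
  have hAB_det : DeterminedBy (Acol ∩ Across) ↑(triStripFinset 0 0 n h) := hcol_det.inter hcross_det
  have hHarris : (triSitePercolation p).real Acol * (triSitePercolation p).real Across ≤
      (triSitePercolation p).real (Acol ∩ Across) :=
    sitePercolation_harris' p hcol_det hcross_det hcol_up (isUpperSet_triHCross 0 0 n h)
  have hindep : (triSitePercolation p).real ((Acol ∩ Across) ∩ Aframe) =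
      (triSitePercolation p).real (Acol ∩ Across) * (triSitePercolation p).real Aframe :=
    sitePercolation_real_inter_of_disjoint p hAB_det (determinedBy_triClosedFrame_annulus (M := M) (by omega))
      (disjoint_strip_annulus n h)
  -- exponent bookkeeping: `j₁ ≤ 2n/L + 1`, `j₂ ≤ 8n/L + 9`
  have hhL1 : h + 1 = L := by omega
  have hLpos : (0 : ℝ) < L := by exact_mod_cast (show 0 < L by omega)
  have hLh : (L : ℝ) = h + 1 := by exact_mod_cast hhL1.symm
  have hhL : (L : ℝ) ≤ 2 * h := by
    have : L ≤ 2 * h := by omega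
    exact_mod_cast this
  have hn0 : (0 : ℝ) ≤ n := Nat.cast_nonneg n
  have hj₁r : (j₁ : ℝ) ≤ 2 * n / L + 1 := by
    have hK : ((n / h : ℕ) : ℝ) * h ≤ n := by exact_mod_cast Nat.div_mul_le_self n h
    have hK0 : (0 : ℝ) ≤ (n / h : ℕ) := Nat.cast_nonneg _
    have hKL := mul_le_mul_of_nonneg_left hhL hK0
    have h1 : (j₁ : ℝ) = (n / h : ℕ) + 1 := by rw [hj₁]; push_cast; ring
    have h2 : (j₁ : ℝ) * L ≤ 2 * n + L := by rw [h1]; nlinarith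
    rw [← sub_le_iff_le_add, le_div_iff₀ hLpos]
    nlinarith
  have hj₂r : (j₂ : ℝ) ≤ 8 * n / L + 9 := by
    have hK : ((4 * M / h : ℕ) : ℝ) * h ≤ (4 * M : ℕ) := by exact_mod_cast Nat.div_mul_le_self (4 * M) h
    have hK0 : (0 : ℝ) ≤ (4 * M / h : ℕ) := Nat.cast_nonneg _
    have hKL := mul_le_mul_of_nonneg_left hhL hK0
    have hM4 : ((4 * M : ℕ) : ℝ) = 4 * n + 4 * L := by rw [hM]; push_cast; rw [hLh]; ring
    have h1 : (j₂ : ℝ) = (4 * M / h : ℕ) + 1 := by rw [hj₂]; push_cast; ring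
    have h2 : (j₂ : ℝ) * L ≤ 8 * n + 9 * L := by rw [h1]; nlinarith
    rw [← sub_le_iff_le_add, le_div_iff₀ hLpos]
    nlinarith
  have hJ : (j₁ : ℝ) + 4 * j₂ ≤ 37 + 34 * n / L := by
    have : (34 : ℝ) * n / L = 2 * n / L + 4 * (8 * n / L) := by ring
    linarith
  have hlogη : Real.log η ≤ 0 := Real.log_nonpos hη.le hη1
  have habs : |Real.log η| = -Real.log η := abs_of_nonpos hlogη
  have hexp : η ^ 37 * Real.exp (-(34 * |Real.log η| / L * n)) ≤ η ^ j₁ * (η ^ j₂) ^ 4 := by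
    have hR : η ^ j₁ * (η ^ j₂) ^ 4 = Real.exp (((j₁ : ℝ) + 4 * j₂) * Real.log η) := by
      rw [← pow_mul, ← pow_add, ← Real.exp_log (pow_pos hη (j₁ + j₂ * 4)), Real.log_pow]
      congr 1
      push_cast
      ring
    have hL' : η ^ 37 * Real.exp (-(34 * |Real.log η| / L * n)) =
        Real.exp ((37 + 34 * n / L) * Real.log η) := by
      rw [← Real.exp_log (pow_pos hη 37), ← Real.exp_add, Real.log_pow, habs]
      congr 1
      push_cast
      ring
    rw [hR, hL', Real.exp_le_exp]
    have : 0 ≤ ((j₁ : ℝ) + 4 * j₂ - (37 + 34 * n / L)) * Real.log η :=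
      mul_nonneg_of_nonpos_of_nonpos (by linarith) hlogη
    linarith
  -- conclusion
  rw [hhL1] at hcol_P
  calc (p : ℝ) ^ L * η ^ 37 * Real.exp (-(34 * |Real.log η| / L * n))
      = (p : ℝ) ^ L * (η ^ 37 * Real.exp (-(34 * |Real.log η| / L * n))) := by ring
    _ ≤ (triSitePercolation p).real Acol * (η ^ j₁ * (η ^ j₂) ^ 4) :=
        mul_le_mul hcol_P hexp (by positivity) measureReal_nonneg
    _ = ((triSitePercolation p).real Acol * η ^ j₁) * (η ^ j₂) ^ 4 := by ring
    _ ≤ ((triSitePercolation p).real Acol * (triSitePercolation p).real Across) *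
          (triSitePercolation p).real Aframe :=
        mul_le_mul (mul_le_mul_of_nonneg_left hcross_P measureReal_nonneg) hframe_P
          (pow_nonneg (pow_nonneg hη.le _) 4) (mul_nonneg measureReal_nonneg measureReal_nonneg)
    _ ≤ (triSitePercolation p).real (Acol ∩ Across) * (triSitePercolation p).real Aframe :=
        mul_le_mul_of_nonneg_right hHarris measureReal_nonneg
    _ = (triSitePercolation p).real ((Acol ∩ Across) ∩ Aframe) := hindep.symm
    _ ≤ (triSitePercolation p).real (triOneArm n ∩ (sitePercolatesAt triGraph 0)ᶜ) :=
        measureReal_mono (column_cross_frame_subset hn) (measure_ne_top _ _)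


/-! ### From the lower bound to `ξ_rad ≥ L_ε / C₂` -/

/-- **The lower bound** from `Nolin2008_RSW` (original form; corollary of
`exp_le_real_triOneArm_finite_of_chain`). [cite: Nolin2008, §7.4 (display before Cor. 42 (arXiv: Cor. 40))] -/
theorem exp_le_real_triOneArm_finite (hRSW : Nolin2008_RSW) {ε : ℝ} (hε : 0 < ε) (hε' : ε < 1 / 2) :
    ∃ η : ℝ, 0 < η ∧ η ≤ 1 ∧ ∀ p : unitInterval, 2 ≤ charLength ε p → ∀ n : ℕ, 1 ≤ n →
      (p : ℝ) ^ charLength ε p * η ^ 37 *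
          Real.exp (-(34 * |Real.log η| / charLength ε p * n)) ≤
        (triSitePercolation p).real (triOneArm n ∩ (sitePercolatesAt triGraph 0)ᶜ) :=
  exp_le_real_triOneArm_finite_of_chain (chainBound_of_RSW hRSW hε hε')

/-- **The lower bound, unconditionally.** [cite: Nolin2008, §7.4 (display before Cor. 42 (arXiv: Cor. 40))] -/
theorem exp_le_real_triOneArm_finite_holds {ε : ℝ} (hε : 0 < ε) (hε' : ε < 1 / 2) :
    ∃ η : ℝ, 0 < η ∧ η ≤ 1 ∧ ∀ p : unitInterval, 2 ≤ charLength ε p → ∀ n : ℕ, 1 ≤ n →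
      (p : ℝ) ^ charLength ε p * η ^ 37 *
          Real.exp (-(34 * |Real.log η| / charLength ε p * n)) ≤
        (triSitePercolation p).real (triOneArm n ∩ (sitePercolatesAt triGraph 0)ᶜ) :=
  exp_le_real_triOneArm_finite_of_chain (chainBound_holds hε hε')

/-- A sequence of probabilities bounded below by `a e^{-bn}` (`a > 0`) has rate sequence
`-log P_n / n` eventually bounded, with `limsup ≤ b`. [folklore] -/
theorem limsup_rateSeq_le_of_exp_le {P : ℕ → ℝ} {a b : ℝ} (ha : 0 < a) (hP1 : ∀ n, P n ≤ 1)
    (hP0 : ∀ n, 0 ≤ P n) (h : ∀ n : ℕ, 1 ≤ n → a * Real.exp (-(b * n)) ≤ P n) :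
    IsBoundedUnder (· ≤ ·) atTop (rateSeq P) ∧ limsup (rateSeq P) atTop ≤ b := by
  have hrate : ∀ n : ℕ, 1 ≤ n → rateSeq P n ≤ -Real.log a / n + b := by
    intro n hn
    have hn0 : (0 : ℝ) < n := by exact_mod_cast hn
    have hPpos : 0 < P n := (mul_pos ha (Real.exp_pos _)).trans_le (h n hn)
    have hlog : Real.log a + -(b * n) ≤ Real.log (P n) := by
      rw [← Real.log_exp (-(b * n)), ← Real.log_mul ha.ne' (Real.exp_pos _).ne']
      exact Real.log_le_log (mul_pos ha (Real.exp_pos _)) (h n hn)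
    unfold rateSeq
    rw [div_add' _ _ _ hn0.ne', div_le_div_iff_of_pos_right hn0]
    linarith
  have hbdd : IsBoundedUnder (· ≤ ·) atTop (rateSeq P) := by
    refine ⟨|Real.log a| + b, ?_⟩
    rw [eventually_map]
    filter_upwards [eventually_ge_atTop 1] with n hn
    have hn1 : (1 : ℝ) ≤ n := by exact_mod_cast hn
    have : -Real.log a / n ≤ |Real.log a| := by
      rw [div_le_iff₀ (by linarith)]
      have := neg_abs_le (Real.log a)
      nlinarith [abs_nonneg (Real.log a)]
    linarith [hrate n hn]
  refine ⟨hbdd, le_of_forall_pos_le_add fun δ hδ => ?_⟩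
  have h0 : ∀ n, 0 ≤ rateSeq P n := fun n => rateSeq_nonneg (hP0 n) (hP1 n)
  refine limsup_le_of_le (isCoboundedUnder_le_of_le atTop h0) ?_
  have hKn : ∀ᶠ n : ℕ in atTop, -Real.log a / n ≤ δ :=
    (tendsto_const_div_atTop_nhds_zero_nat (-Real.log a)).eventually_le_const hδ
  filter_upwards [hKn, eventually_ge_atTop 1] with n hKn hn
  linarith [hrate n hn]

/-- **`ξ_rad ≍ L_ε` near criticality** (Nolin 2008, §7.2, Theorem "Critical exponents" [arXiv: Thm. 31], `ξ ≍ L`, and Cor. 42, for the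
radius-of-a-finite-cluster correlation length `triCorrLength`). Fix `ε ∈ (0, 1/2)` and assume
`ChainBound ε`. There is `C₂ = C₂(ε) > 0` such that for every `p ∈ (0, 1)` with `L = L_ε(p) ≥ 2`
at which the truncated radius decays beyond `L` at rate `c` with constant `C`
(`P_p(0 ↝ ∂S_{kL}, |C(0)| < ∞) ≤ C e^{-ck}`, `k ≥ 1`): `L / C₂ ≤ ξ_rad(p) ≤ 2 L / c`. The lower
bound is `exp_le_real_triOneArm_finite`, the upper bound `div_le_limsup_rateSeq_of_radius_decay`. [cite: Nolin2008, §7.2 Thm. "Critical exponents" (arXiv: Thm. 31) and §7.4 Cor. 42 (arXiv: Cor. 40)] -/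
theorem charLength_div_le_triCorrLength_le_of_chain {ε : ℝ} (hchain0 : ChainBound ε) :
    ∃ C₂ : ℝ, 0 < C₂ ∧ ∀ p : unitInterval, 0 < (p : ℝ) → 2 ≤ charLength ε p →
      ∀ {C c : ℝ}, 0 < C → 0 < c →
        (∀ k : ℕ, 1 ≤ k → (triSitePercolation p).real
          (triBoxArm (k * charLength ε p) ∩ (sitePercolatesAt triGraph 0)ᶜ) ≤
            C * Real.exp (-(c * k))) →
        (charLength ε p : ℝ) / C₂ ≤ triCorrLength p ∧ triCorrLength p ≤ 2 * charLength ε p / c := by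
  obtain ⟨η, hη, hη1, hlow⟩ := exp_le_real_triOneArm_finite_of_chain hchain0
  refine ⟨34 * |Real.log η| + 1, by positivity, fun p hp0 hL C c hC hc hdec => ?_⟩
  set L := charLength ε p with hLdef
  set F : Set (SiteConfig (Site 2)) := (sitePercolatesAt triGraph 0)ᶜ with hF
  set P : ℕ → ℝ := fun n => (triSitePercolation p).real (triOneArm n ∩ F) with hP
  have hLpos : (0 : ℝ) < L := by exact_mod_cast (show 0 < L by omega)
  have ha : 0 < (p : ℝ) ^ L * η ^ 37 := mul_pos (pow_pos hp0 L) (pow_pos hη 37)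
  -- the lower bound on `P n`, with the weaker rate `(34 |log η| + 1) / L`
  have hlowP : ∀ n : ℕ, 1 ≤ n →
      (p : ℝ) ^ L * η ^ 37 * Real.exp (-((34 * |Real.log η| + 1) / L * n)) ≤ P n := by
    intro n hn
    refine le_trans ?_ (hlow p hL n hn)
    have hexp_le : Real.exp (-((34 * |Real.log η| + 1) / L * n)) ≤
        Real.exp (-(34 * |Real.log η| / L * n)) := by
      rw [Real.exp_le_exp, neg_le_neg_iff]
      have hn0 : (0 : ℝ) ≤ n := Nat.cast_nonneg n
      have : 34 * |Real.log η| / L ≤ (34 * |Real.log η| + 1) / L :=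
        div_le_div_of_nonneg_right (by linarith) hLpos.le
      exact mul_le_mul_of_nonneg_right this hn0
    exact mul_le_mul_of_nonneg_left hexp_le ha.le
  obtain ⟨hbdd, hlim⟩ := limsup_rateSeq_le_of_exp_le ha (fun n => measureReal_le_one)
    (fun n => measureReal_nonneg) hlowP
  have hPpos : ∀ n, 1 ≤ n → 0 < P n := fun n hn =>
    (mul_pos ha (Real.exp_pos _)).trans_le (hlowP n hn)
  have hlow' : c / (2 * L) ≤ limsup (rateSeq P) atTop :=
    div_le_limsup_rateSeq_of_radius_decay p (by omega) hC hc hdec hPpos hbdd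
  have hpos : 0 < limsup (rateSeq P) atTop := lt_of_lt_of_le (by positivity) hlow'
  have hrad : triCorrLength p = (limsup (rateSeq P) atTop)⁻¹ := rfl
  constructor
  · rw [hrad, div_eq_mul_inv, ← one_div]
    calc (L : ℝ) * (1 / (34 * |Real.log η| + 1))
        = ((34 * |Real.log η| + 1) / L)⁻¹ := by rw [inv_div]; ring
      _ ≤ (limsup (rateSeq P) atTop)⁻¹ := inv_anti₀ hpos hlim
  · rw [hrad]
    calc (limsup (rateSeq P) atTop)⁻¹ ≤ (c / (2 * L))⁻¹ := inv_anti₀ (by positivity) hlow'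
      _ = 2 * L / c := by rw [inv_div]

/-! ### Assembly without Smirnov–Werner's Thm. 1 (iv) -/

/-- If `log L / log d → κ` along `l` and `d → 0⁺`, then `log (L / C) / log d → κ` for a constant
`C > 0`. [folklore] -/
theorem tendsto_log_div_const_div {l : Filter ℝ} {L d : ℝ → ℝ} {κ C : ℝ} (hC : 0 < C)
    (hd : Tendsto d l (𝓝[>] 0)) (hLpos : ∀ᶠ x in l, 0 < L x)
    (hL : Tendsto (fun x => Real.log (L x) / Real.log (d x)) l (𝓝 κ)) :
    Tendsto (fun x => Real.log (L x / C) / Real.log (d x)) l (𝓝 κ) := by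
  have hlogd : Tendsto (fun x => Real.log (d x)) l atBot := Real.tendsto_log_nhdsGT_zero.comp hd
  have h0 : Tendsto (fun x => Real.log C / Real.log (d x)) l (𝓝 0) :=
    tendsto_const_nhds.div_atBot hlogd
  have := hL.sub h0
  rw [sub_zero] at this
  refine this.congr' ?_
  filter_upwards [hLpos] with x hx
  rw [Real.log_div hx.ne' hC.ne', sub_div]

/-- **`ξ_rad ≍ L_ε`** from `Nolin2008_RSW` (original form). [cite: Nolin2008, §7.2 Thm. "Critical exponents" (arXiv: Thm. 31) and §7.4 Cor. 42 (arXiv: Cor. 40)] -/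
theorem charLength_div_le_triCorrLength_le (hRSW : Nolin2008_RSW) {ε : ℝ} (hε : 0 < ε)
    (hε' : ε < 1 / 2) :
    ∃ C₂ : ℝ, 0 < C₂ ∧ ∀ p : unitInterval, 0 < (p : ℝ) → 2 ≤ charLength ε p →
      ∀ {C c : ℝ}, 0 < C → 0 < c →
        (∀ k : ℕ, 1 ≤ k → (triSitePercolation p).real
          (triBoxArm (k * charLength ε p) ∩ (sitePercolatesAt triGraph 0)ᶜ) ≤
            C * Real.exp (-(c * k))) →
        (charLength ε p : ℝ) / C₂ ≤ triCorrLength p ∧ triCorrLength p ≤ 2 * charLength ε p / c :=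
  charLength_div_le_triCorrLength_le_of_chain (chainBound_of_RSW hRSW hε hε')

/-- **`ξ_rad ≍ L_ε`, unconditionally in the RSW input.** [cite: Nolin2008, §7.2 Thm. "Critical exponents" (arXiv: Thm. 31) and §7.4 Cor. 42 (arXiv: Cor. 40)] -/
theorem charLength_div_le_triCorrLength_le_holds {ε : ℝ} (hε : 0 < ε) (hε' : ε < 1 / 2) :
    ∃ C₂ : ℝ, 0 < C₂ ∧ ∀ p : unitInterval, 0 < (p : ℝ) → 2 ≤ charLength ε p →
      ∀ {C c : ℝ}, 0 < C → 0 < c →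
        (∀ k : ℕ, 1 ≤ k → (triSitePercolation p).real
          (triBoxArm (k * charLength ε p) ∩ (sitePercolatesAt triGraph 0)ᶜ) ≤
            C * Real.exp (-(c * k))) →
        (charLength ε p : ℝ) / C₂ ≤ triCorrLength p ∧ triCorrLength p ≤ 2 * charLength ε p / c :=
  charLength_div_le_triCorrLength_le_of_chain (chainBound_holds hε hε')

/-- **crit-perc.S16, `ν = 4/3` for `triCorrLength`, from the chained bound and the radius decay.** If
`ChainBound ε` holds, if for some `ε ∈ (0, 1/2)` the characteristic length `L_ε` obeys the
two-sided power law `-4/3` (proved in `KestenScaling.lean` from `fourArm_exponent` and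
`Nolin2008_prop34`), and if the radius of the finite cluster of the origin decays exponentially
beyond `L_ε` near `p = 1/2` (Nolin 2008, §7.5), then `ξ_rad(p) = |p - 1/2|^{-4/3 + o(1)}` from
either side (`triCorrLength_exponent`), via `L_ε / C₂ ≤ ξ_rad ≤ (2/c) L_ε`
(`charLength_div_le_triCorrLength_le`) and the squeeze of logarithmic ratios. [cite: Nolin2008, §7.2 Thm. "Critical exponents" (arXiv: Thm. 31), §7.4 Cor. 42 (arXiv: Cor. 40), §7.5 (proof of Lemma 44 (arXiv: Lemma 42))] -/
theorem triCorrLength_exponent_of_chain_charLength {ε : ℝ} (hchain0 : ChainBound ε)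
    (hLr : HasRightPowerLaw (fun p => (charLength ε (Set.projIcc (0 : ℝ) 1 zero_le_one p) : ℝ))
      (1 / 2) (-4 / 3))
    (hLl : HasLeftPowerLaw (fun p => (charLength ε (Set.projIcc (0 : ℝ) 1 zero_le_one p) : ℝ))
      (1 / 2) (-4 / 3))
    {δ C c : ℝ} (hδ : 0 < δ) (hC : 0 < C) (hc : 0 < c)
    (hdec : ∀ p : unitInterval, |(p : ℝ) - 1 / 2| < δ → (p : ℝ) ≠ 1 / 2 → 1 ≤ charLength ε p →
      ∀ k : ℕ, 1 ≤ k → (triSitePercolation p).real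
        (triBoxArm (k * charLength ε p) ∩ (sitePercolatesAt triGraph 0)ᶜ) ≤
          C * Real.exp (-(c * k))) :
    triCorrLength_exponent := by
  obtain ⟨C₂, hC₂, hsand⟩ := charLength_div_le_triCorrLength_le_of_chain hchain0
  set Lr : ℝ → ℝ := fun p => (charLength ε (Set.projIcc (0 : ℝ) 1 zero_le_one p) : ℝ) with hLrdef
  -- the common part of the two one-sided statements
  have key : ∀ {l : Filter ℝ}, Tendsto (fun x : ℝ => |x - 1 / 2|) l (𝓝[>] 0) →
      Tendsto (fun x => Real.log (Lr x) / Real.log |x - 1 / 2|) l (𝓝 (-4 / 3)) →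
      Tendsto (fun x => Real.log (triCorrLengthReal x) / Real.log |x - 1 / 2|) l
        (𝓝 (-4 / 3)) := by
    intro l hd hB
    have hB' : ∀ᶠ x in l, 2 ≤ charLength ε (Set.projIcc 0 1 zero_le_one x) := by
      refine (hB.eventually_ne (show (-4 / 3 : ℝ) ≠ 0 by norm_num)).mono fun x hx => ?_
      by_contra h0
      apply hx
      have h0' : charLength ε (Set.projIcc 0 1 zero_le_one x) = 0 ∨
          charLength ε (Set.projIcc 0 1 zero_le_one x) = 1 := by omega
      have : Real.log (Lr x) = 0 := by
        rcases h0' with h0' | h0' <;>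
          simp only [hLrdef, h0', Nat.cast_zero, Nat.cast_one, Real.log_zero, Real.log_one]
      rw [this, zero_div]
    have hLrpos : ∀ᶠ x in l, 0 < Lr x := hB'.mono fun x hx => by
      simp only [hLrdef]; exact_mod_cast (show 0 < _ by omega)
    have hA : Tendsto (fun x => Real.log (Lr x / C₂) / Real.log |x - 1 / 2|) l (𝓝 (-4 / 3)) :=
      tendsto_log_div_const_div hC₂ hd hLrpos hB
    refine tendsto_log_div_of_sandwich (K := 2 / c) (by positivity) hd hA hB ?_
    have h12 : ∀ᶠ x in l, |x - 1 / 2| ∈ Set.Ioo 0 (min δ (1 / 2)) :=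
      hd.eventually_mem (Ioo_mem_nhdsGT (by positivity))
    filter_upwards [h12, hB'] with x hx12 hxB
    obtain ⟨hx0, hx1⟩ := hx12
    have hxδ : |x - 1 / 2| < δ := hx1.trans_le (min_le_left _ _)
    have hx2 : |x - 1 / 2| < 1 / 2 := hx1.trans_le (min_le_right _ _)
    have hxI : x ∈ Set.Icc (0 : ℝ) 1 := by
      rw [abs_lt] at hx2
      constructor <;> linarith [hx2.1, hx2.2]
    have hproj : Set.projIcc 0 1 zero_le_one x = ⟨x, hxI⟩ := Set.projIcc_of_mem _ hxI
    rw [hproj] at hxB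
    simp only [triCorrLengthReal, hLrdef, hproj]
    have hne : ((⟨x, hxI⟩ : unitInterval) : ℝ) ≠ 1 / 2 := fun h => by
      change x = 1 / 2 at h
      rw [h, sub_self, abs_zero] at hx0
      exact lt_irrefl _ hx0
    have hx01 : 0 < x ∧ x < 1 := by
      rw [abs_lt] at hx2
      constructor <;> linarith [hx2.1, hx2.2]
    have hxB1 : 1 ≤ charLength ε ⟨x, hxI⟩ := le_trans (by norm_num) hxB
    obtain ⟨hlow, hub⟩ := hsand ⟨x, hxI⟩ hx01.1 hxB hC hc (hdec ⟨x, hxI⟩ hxδ hne hxB1)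
    have hLpos : (0 : ℝ) < charLength ε ⟨x, hxI⟩ := by exact_mod_cast (show 0 < _ by omega)
    refine ⟨by positivity, hlow, ?_⟩
    calc triCorrLength ⟨x, hxI⟩ ≤ 2 * (charLength ε ⟨x, hxI⟩ : ℝ) / c := hub
      _ = 2 / c * (charLength ε ⟨x, hxI⟩ : ℝ) := by ring
  -- continuity of `x ↦ |x - 1/2|` at `1/2`
  have habs : Tendsto (fun x : ℝ => |x - 1 / 2|) (𝓝 (1 / 2)) (𝓝 0) := by
    have : Continuous fun x : ℝ => |x - 1 / 2| := (continuous_id.sub continuous_const).abs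
    simpa using this.tendsto (1 / 2)
  constructor
  · have heq : ∀ᶠ x in 𝓝[>] (1 / 2 : ℝ), |x - 1 / 2| = x - 1 / 2 :=
      eventually_nhdsWithin_of_forall fun x hx => abs_of_pos (sub_pos.2 hx)
    have hd : Tendsto (fun x : ℝ => |x - 1 / 2|) (𝓝[>] (1 / 2)) (𝓝[>] 0) :=
      tendsto_nhdsWithin_iff.2 ⟨habs.mono_left nhdsWithin_le_nhds,
        eventually_nhdsWithin_of_forall fun x hx =>
          Set.mem_Ioi.2 (abs_pos.2 (sub_ne_zero.2 (ne_of_gt hx)))⟩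
    have hB : Tendsto (fun x => Real.log (Lr x) / Real.log |x - 1 / 2|)
        (𝓝[>] (1 / 2)) (𝓝 (-4 / 3)) :=
      hLr.congr' (heq.mono fun x hx => by simp only [hx])
    exact (key hd hB).congr' (heq.mono fun x hx => by simp only [hx])
  · have heq : ∀ᶠ x in 𝓝[<] (1 / 2 : ℝ), |x - 1 / 2| = 1 / 2 - x :=
      eventually_nhdsWithin_of_forall fun x hx => by
        rw [abs_sub_comm]; exact abs_of_pos (sub_pos.2 hx)
    have hd : Tendsto (fun x : ℝ => |x - 1 / 2|) (𝓝[<] (1 / 2)) (𝓝[>] 0) :=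
      tendsto_nhdsWithin_iff.2 ⟨habs.mono_left nhdsWithin_le_nhds,
        eventually_nhdsWithin_of_forall fun x hx =>
          Set.mem_Ioi.2 (abs_pos.2 (sub_ne_zero.2 (ne_of_lt hx)))⟩
    have hB : Tendsto (fun x => Real.log (Lr x) / Real.log |x - 1 / 2|)
        (𝓝[<] (1 / 2)) (𝓝 (-4 / 3)) :=
      hLl.congr' (heq.mono fun x hx => by simp only [hx])
    exact (key hd hB).congr' (heq.mono fun x hx => by simp only [hx])

/-- **`ν = 4/3` for `triCorrLength` from `Nolin2008_RSW` and the radius decay** (original form). [cite: Nolin2008, §7.2 Thm. "Critical exponents" (arXiv: Thm. 31), §7.4 Cor. 42 (arXiv: Cor. 40), §7.5 (proof of Lemma 44 (arXiv: Lemma 42))] -/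
theorem triCorrLength_exponent_of_RSW_charLength (hRSW : Nolin2008_RSW) {ε : ℝ} (hε : 0 < ε)
    (hε' : ε < 1 / 2)
    (hLr : HasRightPowerLaw (fun p => (charLength ε (Set.projIcc (0 : ℝ) 1 zero_le_one p) : ℝ))
      (1 / 2) (-4 / 3))
    (hLl : HasLeftPowerLaw (fun p => (charLength ε (Set.projIcc (0 : ℝ) 1 zero_le_one p) : ℝ))
      (1 / 2) (-4 / 3))
    {δ C c : ℝ} (hδ : 0 < δ) (hC : 0 < C) (hc : 0 < c)
    (hdec : ∀ p : unitInterval, |(p : ℝ) - 1 / 2| < δ → (p : ℝ) ≠ 1 / 2 → 1 ≤ charLength ε p →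
      ∀ k : ℕ, 1 ≤ k → (triSitePercolation p).real
        (triBoxArm (k * charLength ε p) ∩ (sitePercolatesAt triGraph 0)ᶜ) ≤
          C * Real.exp (-(c * k))) :
    triCorrLength_exponent :=
  triCorrLength_exponent_of_chain_charLength (chainBound_of_RSW hRSW hε hε') hLr hLl hδ hC hc hdec

/-- **`ν = 4/3` for `triCorrLength` from the power law of `L_ε` and the radius decay, with no RSW
hypothesis.** [cite: Nolin2008, §7.2 Thm. "Critical exponents" (arXiv: Thm. 31), §7.4 Cor. 42 (arXiv: Cor. 40), §7.5 (proof of Lemma 44 (arXiv: Lemma 42))] [cite: BollobasRiordan2006, Ch. 3 Lemma 4, Cor. 5] -/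
theorem triCorrLength_exponent_of_charLength_decay {ε : ℝ} (hε : 0 < ε) (hε' : ε < 1 / 2)
    (hLr : HasRightPowerLaw (fun p => (charLength ε (Set.projIcc (0 : ℝ) 1 zero_le_one p) : ℝ))
      (1 / 2) (-4 / 3))
    (hLl : HasLeftPowerLaw (fun p => (charLength ε (Set.projIcc (0 : ℝ) 1 zero_le_one p) : ℝ))
      (1 / 2) (-4 / 3))
    {δ C c : ℝ} (hδ : 0 < δ) (hC : 0 < C) (hc : 0 < c)
    (hdec : ∀ p : unitInterval, |(p : ℝ) - 1 / 2| < δ → (p : ℝ) ≠ 1 / 2 → 1 ≤ charLength ε p →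
      ∀ k : ℕ, 1 ≤ k → (triSitePercolation p).real
        (triBoxArm (k * charLength ε p) ∩ (sitePercolatesAt triGraph 0)ᶜ) ≤
          C * Real.exp (-(c * k))) :
    triCorrLength_exponent :=
  triCorrLength_exponent_of_chain_charLength (chainBound_holds hε hε') hLr hLl hδ hC hc hdec

/-- **crit-perc.S16 from the near-critical percolation facts, without Smirnov–Werner's
Thm. 1 (iv).** The four-arm exponent `5/4` (`fourArm_exponent`, Smirnov–Werner 2001, Thm. 4),
Kesten's relation `|p - 1/2| L_ε² π₄(L_ε) ≍ 1` (`Nolin2008_prop34`), the Russo–Seymour–Welsh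
theorem (`Nolin2008_RSW`, Nolin 2008, §3.1 [arXiv: Thm. 2]) and the radius decay beyond `L_ε`
(`Nolin2008_radius_decay_at ε`, Nolin 2008, §7.5) at one fixed `ε ∈ (0, 1/2)` imply
`triCorrLength_exponent`: `ξ_rad ≍ L_ε ≈ |p - 1/2|^{-4/3}`. [cite: Nolin2008, §7.2 Thm. "Critical exponents" (arXiv: Thm. 31), §7.3 (display after Prop. 34 (arXiv: Prop. 32))] -/
theorem triCorrLength_exponent_of_RSW_at (h₄ : fourArm_exponent) (hK : Nolin2008_prop34)
    (hRSW : Nolin2008_RSW) {ε : ℝ} (hε : 0 < ε) (hε' : ε < 1 / 2)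
    (hdec : Nolin2008_radius_decay_at ε) : triCorrLength_exponent := by
  obtain ⟨δ, hδ, C, hC, c, hc, hdec⟩ := hdec
  exact triCorrLength_exponent_of_RSW_charLength hRSW hε hε'
    (hasRightPowerLaw_charLength h₄ hK hε hε') (hasLeftPowerLaw_charLength h₄ hK hε hε') hδ hC hc
    hdec

/-- `triCorrLength_exponent_of_RSW_at` with `ε = 1/4`, from the radius decay stated for every
`ε ∈ (0, 1/2)` (`Nolin2008_radius_decay`). [cite: Nolin2008, §7.2 Thm. "Critical exponents" (arXiv: Thm. 31), §7.3 (display after Prop. 34 (arXiv: Prop. 32))] -/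
theorem triCorrLength_exponent_of_RSW (h₄ : fourArm_exponent) (hK : Nolin2008_prop34)
    (hRSW : Nolin2008_RSW) (hdec : Nolin2008_radius_decay) : triCorrLength_exponent :=
  triCorrLength_exponent_of_RSW_at h₄ hK hRSW (ε := 1 / 4) (by norm_num) (by norm_num)
    (hdec (1 / 4) (by norm_num) (by norm_num))

/-- The same at a fixed `ε ∈ (0, 1/2)`, with the radius decay split into Nolin's Lemma 39 at `ε`
(uniform exponential decay below `1/2`) and the supercritical white-circuit bound at `ε`
(`NearCriticalCorrelationLength.lean`). This is the form in which the remaining inputs are to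
be discharged: Lemma 39 is first proved for `ε` below a threshold given by RSW (Nolin 2008,
proof of Lemma 39), and one such `ε` suffices here. [cite: Nolin2008, §7.2 Thm. "Critical exponents" (arXiv: Thm. 31), §7.4 Lemma 39 (arXiv: Lemma 37), §7.5 (proof of Lemma 44 (arXiv: Lemma 42))] -/
theorem triCorrLength_exponent_of_RSW_lemma39_at (h₄ : fourArm_exponent) (hK : Nolin2008_prop34)
    (hRSW : Nolin2008_RSW) {ε : ℝ} (hε : 0 < ε) (hε' : ε < 1 / 2) (h37 : Nolin2008_lemma39_at ε)
    (hsup : Nolin2008_radius_decay_supercritical_at ε) : triCorrLength_exponent :=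
  triCorrLength_exponent_of_RSW_at h₄ hK hRSW hε hε' (Nolin2008_radius_decay_at_of_lemma39_at h37 hsup)

/-- **crit-perc.S16 without any RSW hypothesis**: the four-arm exponent, Kesten's relation and the
radius decay beyond `L_ε` at one `ε ∈ (0, 1/2)` imply `triCorrLength_exponent`. [cite: Nolin2008, §7.2 Thm. "Critical exponents" (arXiv: Thm. 31), §7.3 (display after Prop. 34 (arXiv: Prop. 32))] [cite: BollobasRiordan2006, Ch. 3 Lemma 4, Cor. 5] -/
theorem triCorrLength_exponent_of_charLength_at (h₄ : fourArm_exponent) (hK : Nolin2008_prop34)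
    {ε : ℝ} (hε : 0 < ε) (hε' : ε < 1 / 2) (hdec : Nolin2008_radius_decay_at ε) : triCorrLength_exponent := by
  obtain ⟨δ, hδ, C, hC, c, hc, hdec⟩ := hdec
  exact triCorrLength_exponent_of_charLength_decay hε hε'
    (hasRightPowerLaw_charLength h₄ hK hε hε') (hasLeftPowerLaw_charLength h₄ hK hε hε') hδ hC hc
    hdec

/-- **The same with the radius decay split** into Nolin's Lemma 39 at `ε` and the supercritical
white-circuit bound at `ε`: `fourArm_exponent → Nolin2008_prop34 → Nolin2008_lemma39_at ε →
Nolin2008_radius_decay_supercritical_at ε → triCorrLength_exponent`, no RSW hypothesis. [cite: Nolin2008, §7.2 Thm. "Critical exponents" (arXiv: Thm. 31), §7.4 Lemma 39 (arXiv: Lemma 37), §7.5 (proof of Lemma 44 (arXiv: Lemma 42))] [cite: BollobasRiordan2006, Ch. 3 Lemma 4, Cor. 5] -/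
theorem triCorrLength_exponent_of_lemma39_at (h₄ : fourArm_exponent) (hK : Nolin2008_prop34)
    {ε : ℝ} (hε : 0 < ε) (hε' : ε < 1 / 2) (h37 : Nolin2008_lemma39_at ε)
    (hsup : Nolin2008_radius_decay_supercritical_at ε) : triCorrLength_exponent :=
  triCorrLength_exponent_of_charLength_at h₄ hK hε hε' (Nolin2008_radius_decay_at_of_lemma39_at h37 hsup)

end Literature.Probability.Percolation
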